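import Summits.ABC.StewartYu.MatveevLeverMatrix
import Summits.ABC.StewartYu.WeightedLatticeBasis
import HarnessLib

/-!
# The Matveev–Nesterenko sublattice lever (geometry-of-numbers core of Nesterenko 2003, Prop. 2.6)

Cell topic `Summits/ABC/StewartYu` (cell abc-stewartyu, seat p4); namespace
`Summit.ABC.StewartYu.MatveevLever` (theorems only; matrix lemmas in `MatveevLeverMatrix.lean`).
Place-free input of the Gen-3 (`cⁿ`-quality) engines of rung A1.M3 (route
`PadicPrimesKummerThird`): the end of the zero-estimate argument (Nesterenko 2003, §5.2) produces
a sublattice `Φ ⊂ ℤⁿ` of rank `ν` containing a multiple of the coefficient vector `b` and of small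
weighted covolume; the present lemma turns `Φ` into `ν` short vectors `z₁, …, z_ν ∈ Φ` and an
integer relation `m₀ b = ∑ mᵢ zᵢ` with controlled `m₀, mᵢ` (Nesterenko 2003, proof of Prop. 2.6,
(2.9)–(2.13), LNM 1819 pp. 57–58), which is what the induction on the number of logarithms
consumes (archimedean and `p`-adic alike: the place enters only afterwards).

For weights `A₁, …, Aₙ > 0` write `‖x‖_A = ∑ⱼ Aⱼ |xⱼ|`. PROVED here (`exists_short_relation`):
for a `ℤ`-independent family `a₁, …, a_ν ∈ ℤⁿ` (a basis of `Φ`) and `b` with `k b ∈ Φ`, `k ≠ 0`,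
there are `ℤ`-independent `z₁, …, z_ν ∈ Φ`, integers `m₀ ≠ 0`, `m₁, …, m_ν` with
`m₀ b = ∑ mᵢ zᵢ`, and a set `J` of `ν` columns with
(2.13) `∏ᵢ ‖zᵢ‖_A · vol{y ∈ ℝ^ν ; ‖∑ yᵢ aᵢ‖_A < 1} ≤ 2^ν` — Minkowski's second theorem (the
tree's `Dioph.exists_directional_system_prod_mul_volume_le` [EvertseGyory2015, Thm 4.3.1]) for
the norm `y ↦ ‖∑ yᵢaᵢ‖_A` on `ℝ^ν`; in basis coordinates `V(𝔎)/V(Φ) = vol{y ; ‖∑ yᵢaᵢ‖_A < 1}`,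
so this is the printed `Ω' ≤ 2^ν V(Φ)/V(𝔎)` —,
(2.11) `|m₀| · ∏_{j ∈ J} Aⱼ ≤ ∏ᵢ ‖zᵢ‖_A`, and
(2.12) `|mᵢ| · ∏_{j ∈ J} Aⱼ ≤ (∑_{j ∈ J} |bⱼ| Aⱼ) · ∏_{i' ≠ i} ‖z_{i'}‖_A`.
With `A₁ ≤ ⋯ ≤ Aₙ` one has `∏_{j∈J} Aⱼ ≥ A₁⋯A_ν`, which gives the printed forms of (2.11)/(2.12).

WHAT THIS IS NOT: not Prop. 2.6 itself (its wrapper around the induction hypothesis (2.4) on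
linear forms is engine-side, ≈ 15 lines once the hypothesis is typed), not the volume comparison
(5.19)–(5.21) between `vol{‖∑ yᵢaᵢ‖_A < 1}` and the minors sum of the zero estimate (sequel),
no numerics.

## References

* [Nesterenko2003] Yu. V. Nesterenko, *Linear forms in logarithms of rational numbers*, in:
  Diophantine Approximation (Cetraro 2000), LNM 1819, Springer 2003, 53–106: Prop. 2.6 and its
  proof, (2.8)–(2.13), pp. 57–58.
* [Matveev2000] E. M. Matveev, *An explicit lower bound for a homogeneous rational linear form in
  logarithms of algebraic numbers. II*, Izv. Math. 64 (2000), 1217–1269 (the original lever).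
* [EvertseGyory2015] J.-H. Evertse, K. Győry, *Unit Equations in Diophantine Number Theory*,
  CUP 2015, Thm 4.3.1 (Minkowski's second theorem, as proved in the tree).
-/

noncomputable section

namespace Summit.ABC.StewartYu.MatveevLever

open Matrix Finset MeasureTheory Module
open Literature.NumberTheory.DiophantineGeometry.Dioph
open Summit.ABC.StewartYu.PrincipalLattice

/-! ### The lever -/

/-- **The Matveev–Nesterenko sublattice lever** (geometry-of-numbers core of Nesterenko 2003,
Prop. 2.6). Let `A₁, …, Aₙ > 0`, `‖x‖_A = ∑ⱼ Aⱼ|xⱼ|`, let `a₁, …, a_ν ∈ ℤⁿ` (`ν ≥ 1`) be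
`ℤ`-linearly independent (a basis of the sublattice `Φ`), and let `b ∈ ℤⁿ` with `k b = ∑ cᵢ aᵢ`
for some integer `k ≠ 0` (`b ∈ ⟨Φ⟩`). Then there are `ℤ`-independent `z₁, …, z_ν ∈ Φ`, integers
`m₀ ≠ 0, m₁, …, m_ν` with `m₀ b = ∑ᵢ mᵢ zᵢ`, and a set `J` of `ν` coordinates such that
(2.13) `∏ᵢ ‖zᵢ‖_A · vol{y ∈ ℝ^ν ; ‖∑ᵢ yᵢ aᵢ‖_A < 1} ≤ 2^ν` (this volume is finite; it is
`V(𝔎)/V(Φ)` in the coordinates of the basis `a`), (2.11) `|m₀| ∏_{j∈J} Aⱼ ≤ ∏ᵢ ‖zᵢ‖_A`, and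
(2.12) `|mᵢ| ∏_{j∈J} Aⱼ ≤ (∑_{j∈J} |bⱼ|Aⱼ) · ∏_{i'≠i} ‖z_{i'}‖_A` for every `i`. The `zᵢ` are
the successive-minima vectors of Minkowski's second theorem for the norm `y ↦ ‖∑ yᵢaᵢ‖_A` on
`ℝ^ν` (tree: `Dioph.exists_directional_system_prod_mul_volume_le`), `J` indexes a non-singular
minor `Δ` of `(zᵢⱼ)`, `m₀ = Δ` and `mᵢ = Δᵢ` are Cramer's determinants, and (2.11)/(2.12) are
the `ℓ¹` Hadamard inequality for `Δ · ∏_{j∈J} Aⱼ = det(z_{ij}Aⱼ)_{i, j∈J}`.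
[cite: Nesterenko2003, Prop 2.6 (proof), (2.9)–(2.13), pp. 57–58] -/
theorem exists_short_relation {n ν : ℕ} (hν : 0 < ν) (A : Fin n → ℝ) (hA : ∀ j, 0 < A j)
    (a : Fin ν → (Fin n → ℤ)) (ha : LinearIndependent ℤ a)
    (b : Fin n → ℤ) (k : ℤ) (hk : k ≠ 0) (c : Fin ν → ℤ) (hb : k • b = ∑ i, c i • a i) :
    ∃ (z : Fin ν → (Fin n → ℤ)) (m₀ : ℤ) (m : Fin ν → ℤ) (J : Finset (Fin n)),
      (∀ i, z i ∈ Submodule.span ℤ (Set.range a)) ∧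
      LinearIndependent ℤ z ∧
      m₀ ≠ 0 ∧
      m₀ • b = ∑ i, m i • z i ∧
      J.card = ν ∧
      volume {y : Fin ν → ℝ | ∑ j, A j * |∑ i, y i * (a i j : ℝ)| < 1} < ⊤ ∧
      (∏ i, ∑ j, A j * |(z i j : ℝ)|) *
          (volume {y : Fin ν → ℝ | ∑ j, A j * |∑ i, y i * (a i j : ℝ)| < 1}).toReal ≤ 2 ^ ν ∧
      |(m₀ : ℝ)| * ∏ j ∈ J, A j ≤ ∏ i, ∑ j, A j * |(z i j : ℝ)| ∧
      ∀ i, |(m i : ℝ)| * ∏ j ∈ J, A j ≤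
        (∑ j ∈ J, |(b j : ℝ)| * A j) * ∏ i' ∈ univ.erase i, ∑ j, A j * |(z i' j : ℝ)| := by
  classical
  -- the Gram determinant of the basis
  have hGram : (Matrix.of a * (Matrix.of a)ᵀ).det ≠ 0 :=
    det_mul_transpose_self_ne_zero (Matrix.of a) (by exact ha)
  set Aℝ : Matrix (Fin ν) (Fin n) ℝ := (Matrix.of a).map (Int.castRingHom ℝ) with hAℝ
  have hAℝ_apply : ∀ i j, Aℝ i j = (a i j : ℝ) := fun i j => by simp [hAℝ]
  have hGramℝ : (Aℝ * Aℝᵀ).det ≠ 0 := by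
    rw [hAℝ, ← Matrix.transpose_map, ← Matrix.map_mul, det_map_castRingHom]
    exact_mod_cast hGram
  -- the weighted norm and its pull-back to `ℝ^ν`
  obtain ⟨F, hF, hF0⟩ := exists_seminorm_weighted A hA
  set T : (Fin ν → ℝ) →ₗ[ℝ] (Fin n → ℝ) := Matrix.vecMulLinear Aℝ with hT
  have hTy : ∀ y : Fin ν → ℝ, T y = y ᵥ* Aℝ := fun y => rfl
  have hTapply : ∀ y : Fin ν → ℝ, ∀ j, T y j = ∑ i, y i * (a i j : ℝ) := fun y j => by
    rw [hTy]
    simp [Matrix.vecMul, dotProduct, hAℝ_apply]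
  set N : Seminorm ℝ (Fin ν → ℝ) := F.comp T with hNdef
  have hNapply : ∀ y : Fin ν → ℝ, N y = ∑ j, A j * |∑ i, y i * (a i j : ℝ)| := fun y => by
    rw [hNdef, Seminorm.comp_apply, hF]
    exact Finset.sum_congr rfl fun j _ => by rw [hTapply]
  have hN0 : ∀ y, N y = 0 → y = 0 := fun y hy => by
    have h1 : T y = 0 := hF0 _ (by rw [hNdef, Seminorm.comp_apply] at hy; exact hy)
    have h2 : y ᵥ* Aℝ = 0 := by rw [← hTy]; exact h1
    have h3 : y ᵥ* (Aℝ * Aℝᵀ) = 0 := by rw [← Matrix.vecMul_vecMul, h2, Matrix.zero_vecMul]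
    exact Matrix.eq_zero_of_vecMul_eq_zero hGramℝ h3
  -- Minkowski's second theorem
  obtain ⟨v, hvli, -, -, hvol⟩ := exists_directional_system_prod_mul_volume_le hν N hN0
  -- the short vectors `z k = ∑ i, v k i • a i`
  set V : Matrix (Fin ν) (Fin ν) ℤ := Matrix.of v with hV
  set Z : Matrix (Fin ν) (Fin n) ℤ := V * Matrix.of a with hZ
  have hz_apply : ∀ i j, Z i j = ∑ l, v i l * a l j := fun i j => by
    simp [hZ, hV, Matrix.mul_apply]
  have hz_cast : ∀ i j, (Z i j : ℝ) = ∑ l, (v i l : ℝ) * (a l j : ℝ) := fun i j => by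
    rw [hz_apply]; push_cast; rfl
  have hz_sum : ∀ i, Z i = ∑ l, v i l • a l := fun i => by
    funext j; rw [hz_apply, Finset.sum_apply]; simp
  have hNz : ∀ i, N (fun l => (v i l : ℝ)) = ∑ j, A j * |(Z i j : ℝ)| := fun i => by
    rw [hNapply]
    exact Finset.sum_congr rfl fun j _ => by rw [hz_cast]
  -- `det V ≠ 0` (the minima vectors are independent)
  have hVℝdet : (V.map (Int.castRingHom ℝ)).det ≠ 0 := by
    intro h0
    obtain ⟨g, hg0, hg⟩ := Matrix.exists_vecMul_eq_zero_iff.mpr h0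
    rw [Matrix.vecMul_eq_sum] at hg
    refine hg0 (funext fun l => Fintype.linearIndependent_iff.mp hvli g ?_ l)
    funext i
    have h := congrFun hg i
    simpa [Finset.sum_apply, Pi.smul_apply, hV] using h
  have hVdet : V.det ≠ 0 := by
    rw [det_map_castRingHom] at hVℝdet; exact_mod_cast hVℝdet
  -- `z i ∈ Φ`
  have hzΦ : ∀ i, Z i ∈ Submodule.span ℤ (Set.range a) := fun i => by
    rw [hz_sum]
    exact Submodule.sum_mem _ fun l _ => Submodule.smul_mem _ _ (Submodule.subset_span ⟨l, rfl⟩)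
  -- `z` is `ℤ`-independent
  have hzli : LinearIndependent ℤ (fun i => Z i) := by
    rw [Fintype.linearIndependent_iff]
    intro g hg
    have h1 : ∑ l, (g ᵥ* V) l • a l = 0 := by
      rw [← hg]
      funext j
      simp only [Finset.sum_apply, Pi.smul_apply, smul_eq_mul, Matrix.vecMul, dotProduct,
        hz_apply, hV, Matrix.of_apply, Finset.sum_mul, Finset.mul_sum]
      rw [Finset.sum_comm]
      exact Finset.sum_congr rfl fun l _ => Finset.sum_congr rfl fun i _ => by ring
    have h2 : ∀ l, (g ᵥ* V) l = 0 := Fintype.linearIndependent_iff.mp ha _ h1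
    exact congrFun (Matrix.eq_zero_of_vecMul_eq_zero hVdet (funext h2))
  -- a non-singular minor of `Z`
  obtain ⟨e, he, hdet⟩ := exists_cols_det_ne_zero Z hzli
  set Nm : Matrix (Fin ν) (Fin ν) ℤ := Matrix.of fun i l => Z i (e l) with hNm
  have hNmZ : Nm = Z.submatrix id e := by
    ext i l; simp [hNm]
  have hdet' : Nm.det ≠ 0 := by rw [hNmZ]; exact hdet
  -- an integer relation `(k det V) b = ∑ c' z` (via the adjugate of `V`)
  have hAZ : V.adjugate * Z = V.det • Matrix.of a := by
    rw [hZ, ← Matrix.mul_assoc, Matrix.adjugate_mul, Matrix.smul_mul, Matrix.one_mul]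
  have hadj : ∀ l j, ∑ i, V.adjugate l i * Z i j = V.det * a l j := fun l j => by
    have h := congrFun (congrFun hAZ l) j
    simpa [Matrix.mul_apply] using h
  set c' : Fin ν → ℤ := fun i => ∑ l, c l * V.adjugate l i with hc'
  have hrel' : (k * V.det) • b = ∑ i, c' i • (Z i) := by
    funext j
    have hbj : k * b j = ∑ l, c l * a l j := by
      have h := congrFun hb j
      simpa [Finset.sum_apply, Pi.smul_apply] using h
    simp only [Pi.smul_apply, smul_eq_mul, Finset.sum_apply, hc']
    calc k * V.det * b j = V.det * (k * b j) := by ring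
      _ = ∑ l, c l * (V.det * a l j) := by
          rw [hbj, Finset.mul_sum]; exact Finset.sum_congr rfl fun l _ => by ring
      _ = ∑ l, ∑ i, c l * V.adjugate l i * Z i j := by
          refine Finset.sum_congr rfl fun l _ => ?_
          rw [← hadj, Finset.mul_sum]
          exact Finset.sum_congr rfl fun i _ => by ring
      _ = ∑ i, (∑ l, c l * V.adjugate l i) * Z i j := by
          rw [Finset.sum_comm]
          exact Finset.sum_congr rfl fun i _ => by rw [Finset.sum_mul]
  have hkV : k * V.det ≠ 0 := mul_ne_zero hk hVdet
  -- Cramer lift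
  set bJ : Fin ν → ℤ := fun l => b (e l) with hbJ
  set m : Fin ν → ℤ := Matrix.cramer Nmᵀ bJ with hm
  have hrel : Nm.det • b = ∑ i, m i • Z i :=
    det_smul_eq_sum_cramer_smul (fun i => Z i) e hdet' b (k * V.det) hkV c' hrel'
  -- the column set `J`
  set J : Finset (Fin n) := univ.image e with hJ
  have hJcard : J.card = ν := by
    rw [hJ, Finset.card_image_of_injective _ he, Finset.card_univ, Fintype.card_fin]
  have hprodJ : ∏ j ∈ J, A j = ∏ l, A (e l) := by
    rw [hJ, Finset.prod_image fun x _ y _ h => he h]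
  have hsumJ : ∑ j ∈ J, |(b j : ℝ)| * A j = ∑ l, |(b (e l) : ℝ)| * A (e l) := by
    rw [hJ, Finset.sum_image fun x _ y _ h => he h]
  -- the norms are positive; their product `P`
  set P : ℝ := ∏ i, ∑ j, A j * |(Z i j : ℝ)| with hP
  have hterm_nonneg : ∀ i j, 0 ≤ A j * |(Z i j : ℝ)| := fun i j =>
    mul_nonneg (hA j).le (abs_nonneg _)
  have hrow_pos : ∀ i, 0 < ∑ j, A j * |(Z i j : ℝ)| := fun i => by
    have hzi : Z i ≠ 0 := hzli.ne_zero i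
    obtain ⟨j, hj⟩ : ∃ j, Z i j ≠ 0 := by
      by_contra h
      push Not at h
      exact hzi (funext h)
    have hj' : 0 < A j * |(Z i j : ℝ)| :=
      mul_pos (hA j) (abs_pos.mpr (by exact_mod_cast hj))
    exact lt_of_lt_of_le hj'
      (Finset.single_le_sum (f := fun j => A j * |(Z i j : ℝ)|) (fun j _ => hterm_nonneg i j)
        (Finset.mem_univ j))
  have hPpos : 0 < P := Finset.prod_pos fun i _ => hrow_pos i
  -- Minkowski in real form
  have hSet : {x : Fin ν → ℝ | N x < 1} =
      {y : Fin ν → ℝ | ∑ j, A j * |∑ i, y i * (a i j : ℝ)| < 1} := by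
    ext y
    simp only [Set.mem_setOf_eq, hNapply]
  have hprodN : ∏ l, N (fun i => (v l i : ℝ)) = P := by
    rw [hP]; exact Finset.prod_congr rfl fun l _ => hNz l
  rw [hprodN, hSet] at hvol
  set S := {y : Fin ν → ℝ | ∑ j, A j * |∑ i, y i * (a i j : ℝ)| < 1} with hS
  have hPne : ENNReal.ofReal P ≠ 0 := by
    rw [ne_eq, ENNReal.ofReal_eq_zero, not_le]; exact hPpos
  have htwo : (2 : ENNReal) ^ ν ≠ ⊤ := ENNReal.pow_ne_top (by simp)
  have hStop : volume S < ⊤ := by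
    by_contra htop
    rw [not_lt, top_le_iff] at htop
    rw [htop, ENNReal.mul_top hPne, top_le_iff] at hvol
    exact htwo hvol
  have hreal : P * (volume S).toReal ≤ 2 ^ ν := by
    have h1 : (ENNReal.ofReal P * volume S).toReal ≤ ((2 : ENNReal) ^ ν).toReal :=
      ENNReal.toReal_mono htwo hvol
    rw [ENNReal.toReal_mul, ENNReal.toReal_ofReal hPpos.le] at h1
    simpa using h1
  -- (2.11): Hadamard for the minor
  set Nℝ : Matrix (Fin ν) (Fin ν) ℝ := Nm.map (Int.castRingHom ℝ) with hNℝ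
  have hNℝ_apply : ∀ i l, Nℝ i l = (Z i (e l) : ℝ) := fun i l => by simp [hNℝ, hNm]
  have hNℝdet : Nℝ.det = (Nm.det : ℝ) := by rw [hNℝ, det_map_castRingHom]
  have hrowJ_le : ∀ i, ∑ l, |(Z i (e l) : ℝ)| * A (e l) ≤ ∑ j, A j * |(Z i j : ℝ)| := fun i => by
    calc ∑ l, |(Z i (e l) : ℝ)| * A (e l) = ∑ j ∈ J, A j * |(Z i j : ℝ)| := by
          rw [hJ, Finset.sum_image fun x _ y _ h => he h]
          exact Finset.sum_congr rfl fun l _ => mul_comm _ _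
      _ ≤ ∑ j, A j * |(Z i j : ℝ)| :=
          Finset.sum_le_sum_of_subset_of_nonneg (Finset.subset_univ _)
            fun j _ _ => hterm_nonneg i j
  have h211 : |(Nm.det : ℝ)| * ∏ l, A (e l) ≤ P := by
    have h := abs_det_mul_prod_le Nℝ (fun l => A (e l)) (fun l => (hA (e l)).le)
    rw [hNℝdet] at h
    refine h.trans ?_
    rw [hP]
    refine Finset.prod_le_prod (fun i _ => Finset.sum_nonneg fun l _ =>
      mul_nonneg (abs_nonneg _) (hA _).le) fun i _ => ?_
    calc ∑ l, |Nℝ i l| * A (e l) = ∑ l, |(Z i (e l) : ℝ)| * A (e l) :=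
          Finset.sum_congr rfl fun l _ => by rw [hNℝ_apply]
      _ ≤ ∑ j, A j * |(Z i j : ℝ)| := hrowJ_le i
  -- (2.12): Hadamard for the Cramer numerators
  have h212 : ∀ i, |(m i : ℝ)| * ∏ l, A (e l) ≤
      (∑ l, |(b (e l) : ℝ)| * A (e l)) * ∏ i' ∈ univ.erase i, ∑ j, A j * |(Z i' j : ℝ)| := by
    intro i
    have hmi : m i = (Nm.updateRow i bJ).det := by
      rw [hm, Matrix.cramer_apply, Matrix.updateCol_transpose, Matrix.det_transpose]
    set R : Matrix (Fin ν) (Fin ν) ℝ := (Nm.updateRow i bJ).map (Int.castRingHom ℝ) with hR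
    have hRdet : R.det = ((Nm.updateRow i bJ).det : ℝ) := by rw [hR, det_map_castRingHom]
    have hR_self : ∀ l, R i l = (b (e l) : ℝ) := fun l => by
      simp [hR, hbJ, Matrix.updateRow_apply]
    have hR_ne : ∀ i', i' ≠ i → ∀ l, R i' l = (Z i' (e l) : ℝ) := fun i' hi' l => by
      simp [hR, hNm, Matrix.updateRow_apply, hi']
    have h := abs_det_mul_prod_le R (fun l => A (e l)) (fun l => (hA (e l)).le)
    rw [hRdet, ← hmi] at h
    refine h.trans ?_
    rw [← Finset.mul_prod_erase univ (fun i' => ∑ l, |R i' l| * A (e l)) (Finset.mem_univ i)]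
    have hfac_nonneg : ∀ i', 0 ≤ ∑ l, |R i' l| * A (e l) := fun i' =>
      Finset.sum_nonneg fun l _ => mul_nonneg (abs_nonneg _) (hA _).le
    refine mul_le_mul ?_ ?_ (Finset.prod_nonneg fun i' _ => hfac_nonneg i')
      (Finset.sum_nonneg fun l _ => mul_nonneg (abs_nonneg _) (hA _).le)
    · exact le_of_eq (Finset.sum_congr rfl fun l _ => by rw [hR_self])
    · refine Finset.prod_le_prod (fun i' _ => hfac_nonneg i') fun i' hi' => ?_
      have hne : i' ≠ i := Finset.ne_of_mem_erase hi'
      calc ∑ l, |R i' l| * A (e l) = ∑ l, |(Z i' (e l) : ℝ)| * A (e l) :=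
            Finset.sum_congr rfl fun l _ => by rw [hR_ne i' hne]
        _ ≤ ∑ j, A j * |(Z i' j : ℝ)| := hrowJ_le i'
  -- assemble
  refine ⟨fun i => Z i, Nm.det, m, J, hzΦ, hzli, hdet', hrel, hJcard, hStop, hreal, ?_,
    fun i => ?_⟩
  · rw [hprodJ]; exact h211
  · rw [hprodJ, hsumJ]; exact h212 i

end Summit.ABC.StewartYu.MatveevLever

end
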